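import Summits.AtomisticToContinuum.BoseEinsteinCondensation.Theses.BlockLatticeFSum
import Summits.AtomisticToContinuum.BoseEinsteinCondensation.Theorems.BlockLatticeFSumKinematics

/-!
# `ShellModeCounting` BY NAME (route `BlockLatticeFSum`, support item stmt-AtomisticToContinuum-27508)
decomp-a2c lens-6 g22.  Inputs: the kinematics kit (Parseval on the block span, unconditional) and pure
bookkeeping: window choice `4 ∣ K`, Chebyshev on the shell `ε ≥ θ`, the deep-infrared hypothesis, `13595`, the
budget hypothesis; output `n₀ ≥ (5/8)·N`, i.e. the antecedent of `BoundaryTransferWeak` with `c = 5/8`.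
No `sorry`, no new definitions.
-/

namespace Summit.AtomisticToContinuum.BoseEinsteinCondensation.Theses.BlockLatticeFSum.SMC

open MeasureTheory Complex Filter
open scoped ENNReal NNReal BigOperators Topology
open Literature.MathematicalPhysics.QuantumManyBody.BoseGas

/-! ## 1. Abstract shell counting (ENNReal bookkeeping only) -/

/-- From mass `≥ (7/8)N` on all modes, weighted budget `Σ ε·n ≤ (θ/8)N`, and deep-shell mass `≤ N/8`,
the zero mode carries `≥ (5/8)N` (Chebyshev on the shell `ε ≥ θ`). -/
theorem counting_abstract {ι : Type*} [Fintype ι] (n : ι → ℝ≥0∞) (ε : ι → ℝ) (q₀ : ι)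
    (D : Finset ι) {θ N : ℝ} (hθ : 0 < θ) (hN : 0 ≤ N)
    (hDm : ∀ q, q ∈ D ↔ (q ≠ q₀ ∧ ε q < θ))
    (hP : ENNReal.ofReal ((1 - 1 / 8) * N) ≤ ∑ q, n q)
    (hS : ∑ q, ENNReal.ofReal (ε q) * n q ≤ ENNReal.ofReal (6 * (θ / 48) * N))
    (hD : ∑ q ∈ D, n q ≤ ENNReal.ofReal (N / 8)) :
    ENNReal.ofReal (5 / 8 * N) ≤ n q₀ := by
  classical
  -- Chebyshev on the high shell
  have hhigh : ∑ q ∈ Finset.univ.filter (fun q => q ≠ q₀ ∧ ¬ ε q < θ), n q ≤ ENNReal.ofReal (N / 8) := by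
    calc ∑ q ∈ Finset.univ.filter (fun q => q ≠ q₀ ∧ ¬ ε q < θ), n q
        ≤ ∑ q ∈ Finset.univ.filter (fun q => q ≠ q₀ ∧ ¬ ε q < θ),
            ENNReal.ofReal θ⁻¹ * (ENNReal.ofReal (ε q) * n q) := by
          refine Finset.sum_le_sum fun q hq => ?_
          rw [Finset.mem_filter] at hq
          have hε : θ ≤ ε q := not_lt.1 hq.2.2
          calc n q = 1 * n q := (one_mul _).symm
            _ ≤ (ENNReal.ofReal θ⁻¹ * ENNReal.ofReal (ε q)) * n q := by
                gcongr
                rw [← ENNReal.ofReal_mul (inv_nonneg.2 hθ.le), ← ENNReal.ofReal_one]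
                refine ENNReal.ofReal_le_ofReal ?_
                rw [inv_mul_eq_div, le_div_iff₀ hθ, one_mul]
                exact hε
            _ = _ := by rw [mul_assoc]
      _ = ENNReal.ofReal θ⁻¹ * ∑ q ∈ Finset.univ.filter (fun q => q ≠ q₀ ∧ ¬ ε q < θ),
            ENNReal.ofReal (ε q) * n q := by rw [Finset.mul_sum]
      _ ≤ ENNReal.ofReal θ⁻¹ * ∑ q, ENNReal.ofReal (ε q) * n q := by
          gcongr
          exact Finset.subset_univ _
      _ ≤ ENNReal.ofReal θ⁻¹ * ENNReal.ofReal (6 * (θ / 48) * N) := by gcongr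
      _ = ENNReal.ofReal (N / 8) := by
          rw [← ENNReal.ofReal_mul (inv_nonneg.2 hθ.le)]
          congr 1
          field_simp
          ring
  -- partition `univ = {q₀} ⊔ deep ⊔ high`
  have hDD : D = (Finset.univ.erase q₀).filter (fun q => ε q < θ) := by
    ext q
    simp [hDm q]
  have hsplit : ∑ q, n q = n q₀ + (∑ q ∈ D, n q
      + ∑ q ∈ Finset.univ.filter (fun q => q ≠ q₀ ∧ ¬ ε q < θ), n q) := by
    rw [← Finset.add_sum_erase Finset.univ _ (Finset.mem_univ q₀)]
    congr 1
    rw [← Finset.sum_filter_add_sum_filter_not (Finset.univ.erase q₀) (fun q => ε q < θ), hDD]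
    congr 1
    refine Finset.sum_congr ?_ fun _ _ => rfl
    ext q
    simp
  have hle : ENNReal.ofReal ((1 - 1 / 8) * N) ≤ n q₀ + ENNReal.ofReal (N / 4) := by
    calc ENNReal.ofReal ((1 - 1 / 8) * N) ≤ ∑ q, n q := hP
      _ = _ := hsplit
      _ ≤ n q₀ + (ENNReal.ofReal (N / 8) + ENNReal.ofReal (N / 8)) :=
          add_le_add le_rfl (add_le_add hD hhigh)
      _ = n q₀ + ENNReal.ofReal (N / 4) := by
          rw [← ENNReal.ofReal_add (by positivity) (by positivity)]
          congr 2
          ring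
  have hsub : ENNReal.ofReal ((1 - 1 / 8) * N) - ENNReal.ofReal (N / 4) ≤ n q₀ :=
    tsub_le_iff_right.2 hle
  calc ENNReal.ofReal (5 / 8 * N) = ENNReal.ofReal ((1 - 1 / 8) * N - N / 4) := by congr 1; ring
    _ = ENNReal.ofReal ((1 - 1 / 8) * N) - ENNReal.ofReal (N / 4) := ENNReal.ofReal_sub _ (by positivity)
    _ ≤ n q₀ := hsub

/-! ## 2. Window choice and the zero mode -/

/-- A multiple of four in the window `[X/2, X]` once `X ≥ 8`. -/
theorem window_choice {X : ℝ} (hX : 8 ≤ X) :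
    ∃ K : ℕ, 4 ∣ K ∧ 0 < K ∧ (K : ℝ) ≤ X ∧ X / 2 ≤ (K : ℝ) := by
  refine ⟨4 * ⌊X / 4⌋₊, dvd_mul_right 4 _, ?_, ?_, ?_⟩
  · have h2 : 2 ≤ ⌊X / 4⌋₊ := Nat.le_floor (by push_cast; linarith)
    omega
  · have := Nat.floor_le (show 0 ≤ X / 4 by linarith)
    push_cast
    linarith
  · have := Nat.lt_floor_add_one (X / 4)
    push_cast
    linarith

/-- The block wave with `q = 0` is the constant mode on the cell. -/
theorem blockWave_zero_eq_constantMode {L : ℝ} {K : ℕ} (hK : 0 < K) (x : EuclideanSpace ℝ (Fin 3))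
    (hx : x ∈ cell L) :
    (fun x : EuclideanSpace ℝ (Fin 3) => (((Real.sqrt (L ^ 3))⁻¹ : ℝ) : ℂ) * Complex.exp (((2 * Real.pi * (∑ j : Fin 3, (((fun _ : Fin 3 => (⟨0, hK⟩ : Fin K)) j : ℕ) : ℝ) * (⌊(K : ℝ) * x j / L⌋ : ℝ)) / (K : ℝ) : ℝ) : ℂ) * Complex.I)) x = constantMode L x := by
  simp [constantMode, Set.indicator_of_mem hx, Complex.ofReal_inv]

/-- `q = 0 ↔ all coordinates vanish`. -/
theorem eq_zero_iff {K : ℕ} (hK : 0 < K) (q : Fin 3 → Fin K) :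
    q = (fun _ : Fin 3 => (⟨0, hK⟩ : Fin K)) ↔ ∀ j : Fin 3, (q j : ℕ) = 0 := by
  constructor
  · rintro rfl j
    rfl
  · intro h
    funext j
    exact Fin.ext (h j)

/-! ## 3. `ShellModeCounting` by name -/

/-- The support item `ShellModeCounting` of route `BlockLatticeFSum` (stmt-AtomisticToContinuum-27508), by name:
Parseval for the block waves, Chebyshev on the shell `ε ≥ θ`, the window `K := 4⌊X/4⌋`, and the three
windows (DIE, 13595, budget) combine to `condensateOccupation ≥ (5/8)·N` (decomp-a2c lens-6 g22). -/
theorem shellModeCounting :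
    Summit.AtomisticToContinuum.BoseEinsteinCondensation.Theses.BlockLatticeFSum.ShellModeCounting := by
  intro hSB hDI hBC v hv
  obtain ⟨A, hA, θ, hθ, ρ₁, hρ₁, hDIv⟩ := hDI v hv
  obtain ⟨ρ₂, hρ₂, N₂, hBCv⟩ := hBC v hv A hA (1 / 8) (by norm_num)
  obtain ⟨ρ₃, hρ₃, N₃, hSBv⟩ := hSB v hv A hA (θ / 48) (by positivity)
  refine ⟨min ρ₁ (min ρ₂ ρ₃), lt_min hρ₁ (lt_min hρ₂ hρ₃), fun ρ hρ hρlt => ?_⟩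
  have hρ1 : ρ < ρ₁ := lt_of_lt_of_le hρlt (min_le_left _ _)
  have hρ2 : ρ < ρ₂ := lt_of_lt_of_le hρlt ((min_le_right _ _).trans (min_le_left _ _))
  have hρ3 : ρ < ρ₃ := lt_of_lt_of_le hρlt ((min_le_right _ _).trans (min_le_right _ _))
  refine ⟨5 / 8, by norm_num, ?_⟩
  have hsρ : 0 < Real.sqrt ρ := Real.sqrt_pos.2 hρ
  have hev := hDIv ρ hρ hρ1
  have hN1 : ∀ᶠ N : ℕ in atTop, max N₂ N₃ ≤ N := eventually_ge_atTop _
  have hN2 : ∀ᶠ N : ℕ in atTop, ρ * (8 * A / Real.sqrt ρ) ^ 3 ≤ (N : ℝ) :=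
    tendsto_natCast_atTop_atTop.eventually_ge_atTop _
  have hN3 : ∀ᶠ N : ℕ in atTop, 1 ≤ N := eventually_ge_atTop 1
  filter_upwards [hev, hN1, hN2, hN3] with N hNDI hNge hNM hNone
  obtain ⟨δ₁, hδ₁, hΨ₁⟩ := hNDI
  have hNpos : 0 < N := hNone
  have hNr : (0 : ℝ) < N := by exact_mod_cast hNpos
  set L : ℝ := sideLength ρ N with hLdef
  have hL : 0 < L := Real.rpow_pos_of_pos (div_pos hNr hρ) _
  have hNL : (N : ℝ) / L ^ 3 = ρ := div_sideLength_pow_three hρ hNpos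
  have hL3 : L ^ 3 = (N : ℝ) / ρ := by
    rw [← hNL]
    field_simp
  have hNρ2 : (N : ℝ) ≤ ρ₂ * L ^ 3 := by
    rw [hL3, mul_div_assoc', le_div_iff₀ hρ]
    nlinarith
  have hNρ3 : (N : ℝ) ≤ ρ₃ * L ^ 3 := by
    rw [hL3, mul_div_assoc', le_div_iff₀ hρ]
    nlinarith
  obtain ⟨δ₂, hδ₂, hΨ₂⟩ := hBCv N L hL ((le_max_left _ _).trans hNge) hNρ2
  obtain ⟨δ₃, hδ₃, hΨ₃⟩ := hSBv N L hL ((le_max_right _ _).trans hNge) hNρ3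
  refine ⟨min δ₁ (min δ₂ δ₃), lt_min hδ₁ (lt_min hδ₂ hδ₃), fun Ψ hE => ?_⟩
  have hE1 : periodicEnergy v Ψ ≤ periodicGroundStateEnergy v N L + δ₁ :=
    hE.trans (add_le_add le_rfl (min_le_left _ _))
  have hE2 : periodicEnergy v Ψ ≤ periodicGroundStateEnergy v N L + δ₂ :=
    hE.trans (add_le_add le_rfl ((min_le_right _ _).trans (min_le_left _ _)))
  have hE3 : periodicEnergy v Ψ ≤ periodicGroundStateEnergy v N L + δ₃ :=
    hE.trans (add_le_add le_rfl ((min_le_right _ _).trans (min_le_right _ _)))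
  -- the side is long enough: L ≥ 8A/√ρ
  have hY : 0 < 8 * A / Real.sqrt ρ := by positivity
  have hLY : 8 * A / Real.sqrt ρ ≤ L := by
    by_contra hcon
    have hlt : L < 8 * A / Real.sqrt ρ := not_le.1 hcon
    have h3 : L ^ 3 < (8 * A / Real.sqrt ρ) ^ 3 := pow_lt_pow_left₀ hlt hL.le three_ne_zero
    have : (N : ℝ) < ρ * (8 * A / Real.sqrt ρ) ^ 3 := by
      rw [hL3] at h3
      rwa [div_lt_iff₀ hρ, mul_comm] at h3
    linarith
  -- choose K
  set X : ℝ := L * Real.sqrt ρ / A with hXdef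
  have hX8 : 8 ≤ X := by
    rw [hXdef, le_div_iff₀ hA]
    have := (div_le_iff₀ hsρ).1 hLY
    linarith
  obtain ⟨K, hK4, hKpos, hKX, hXK⟩ := window_choice hX8
  have hKr : (0 : ℝ) < K := by exact_mod_cast hKpos
  have hKeven : Even K := by
    obtain ⟨m, hm⟩ := hK4
    exact ⟨2 * m, by omega⟩
  have hLX : L / X = A / Real.sqrt ρ := by
    rw [hXdef]
    field_simp
  have hwin : A / Real.sqrt ρ ≤ L / (K : ℝ) ∧ L / (K : ℝ) ≤ 2 * A / Real.sqrt ρ := by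
    constructor
    · rw [← hLX]
      exact div_le_div_of_nonneg_left hL.le hKr hKX
    · have hX2 : 0 < X / 2 := by linarith
      calc L / (K : ℝ) ≤ L / (X / 2) := div_le_div_of_nonneg_left hL.le hX2 hXK
        _ = 2 * (L / X) := by field_simp
        _ = 2 * A / Real.sqrt ρ := by rw [hLX, mul_div_assoc]
  have hwin' : A / Real.sqrt ((N : ℝ) / L ^ 3) ≤ L / (K : ℝ) ∧
      L / (K : ℝ) ≤ 2 * A / Real.sqrt ((N : ℝ) / L ^ 3) := by
    rw [hNL]
    exact hwin
  -- the three inputs and Parseval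
  have hP := hΨ₂ Ψ hE2 K hKeven hKpos hwin'
  have hS := hΨ₃ Ψ hE3 K hK4 hKpos hwin'
  have hD := hΨ₁ Ψ hE1 K hKeven hKpos hwin
  have hPar := Kinematics.parseval_blockWaves_trialState hNpos hKpos hL Ψ
  rw [← hPar] at hP
  -- counting
  have hcount := counting_abstract
    (fun q : Fin 3 → Fin K => cellOccupation N L (fun x : EuclideanSpace ℝ (Fin 3) => (((Real.sqrt (L ^ 3))⁻¹ : ℝ) : ℂ) * Complex.exp (((2 * Real.pi * (∑ j : Fin 3, ((q j : ℕ) : ℝ) * (⌊(K : ℝ) * x j / L⌋ : ℝ)) / (K : ℝ) : ℝ) : ℂ) * Complex.I)) Ψ.ψ)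
    (fun q : Fin 3 → Fin K => ∑ j : Fin 3, (1 - Real.cos (2 * Real.pi * ((q j : ℕ) : ℝ) / (K : ℝ))))
    (fun _ : Fin 3 => (⟨0, hKpos⟩ : Fin K)) _ hθ hNr.le (fun q => ?_) hP hS hD
  · -- identify the zero mode with the condensate mode
    have h0 : cellOccupation N L (fun x : EuclideanSpace ℝ (Fin 3) => (((Real.sqrt (L ^ 3))⁻¹ : ℝ) : ℂ) * Complex.exp (((2 * Real.pi * (∑ j : Fin 3, (((fun _ : Fin 3 => (⟨0, hKpos⟩ : Fin K)) j : ℕ) : ℝ) * (⌊(K : ℝ) * x j / L⌋ : ℝ)) / (K : ℝ) : ℝ) : ℂ) * Complex.I)) Ψ.ψ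
        = condensateOccupation N L Ψ.ψ := by
      rw [Kinematics.cellOccupation_congr (fun x hx => blockWave_zero_eq_constantMode hKpos x hx)]
      simp [cellOccupation, condensateOccupation, constantMode, Set.indicator_indicator]
    rw [h0] at hcount
    exact hcount
  · rw [Finset.mem_filter, ne_eq, eq_zero_iff hKpos q]
    simp

end Summit.AtomisticToContinuum.BoseEinsteinCondensation.Theses.BlockLatticeFSum.SMC
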